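import Literature.Computability.AlgebraicComplexity.KempfNumericalFunction
import Literature.Analysis.Convex.KempfSuperadditiveMaxOnSphere
import Literature.LinearAlgebra.Matrix.BruhatTwoWeights
import Literature.LinearAlgebra.Matrix.WeightFlagSubmodule
import HarnessLib

/-!
# Kempf's optimal one-parameter subgroups for `SL_σ`, III: optimal pairs, the canonical
# destabilising flag, and its stability under the stabiliser (Kempf 1978, Thm. 2.2, Thm. 3.4,
# Cor. 4.4, for `G = SL_σ` acting on forms; any algebraically closed field)

Third file of the programme (`KempfTorusWeights.lean`, `KempfNumericalFunction.lean`). Let `K` be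
algebraically closed (any characteristic), `v ∈ K[x_σ]` a form of degree `D` whose `SL_σ`-orbit is
NOT Zariski closed (`¬ IsPolystable v`). By `SLOrbitOpenInClosure.exists_isPolystable_mem_zariskiClosure`
the orbit closure contains a form `Q` with closed orbit `S = SL·Q ∌ v`; fix a `TestSystem` for `Q`.
A PAIR `(h, a)` — `h ∈ SL_σ(K)`, `a ∈ ℝ^σ` with `∑ a = 0` — stands for Kempf's (virtual)
one-parameter subgroup `h⁻¹ · diag(t^a) · h`; it is admissible when `lim_{t→0}` exists on `v`
(`IsAdm (h·v) a`), and its numerical value is `M(h·v, a)`.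

* §1–§2 **Optimal pairs exist** (`TestSystem.exists_isOpt`; Kempf Thm. 2.2/3.4, existence): the
  data `(admissibility, M)` of `(h, a)` only depend on the STATE `(J(h·v), supp(h·v))`, of which
  there are finitely many (`finite_range_state`); on one state the feasible unit vectors form a
  compact set and `M` is continuous (`exists_max_on_state`, via
  `Analysis/Convex/KempfSuperadditiveMaxOnSphere`); a pair of POSITIVE value exists by
  Hilbert–Mumford (`HilbertMumfordSLForms`) and positivity at the limit (part II)
  (`exists_unit_M_pos`). `TestSystem.IsOpt v h a`: `a` unit, feasible, of maximal value.
* §3 **Transport and uniqueness**: the stabiliser of `v` (`IsOpt.mul_stabilizer`, Kempf Cor. 3.5),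
  the parabolic `P_a` (`IsOpt.parabolic_mul`, Lemma 3.2 (c)) and monomial matrices
  (`IsOpt.of_monomial_mul`, the Weyl group) move optimal pairs to optimal pairs; at a fixed `h` the
  optimal `a` is UNIQUE (`IsOpt.unique`; superadditivity + strict convexity of the Euclidean norm,
  Thm. 2.2).
* §4 **The canonical flag** (`IsOpt.flag_eq`; Thm. 2.2/3.4: `Λ_x` is one `P`-orbit): any two optimal
  pairs define the same weight flag `F(h, a, r) = {x : a_i < r ⇒ (h x)_i = 0}` (the def-free
  `(Submodule.pi {i | a i < r} ⊥).comap h.mulVecLin` of `LinearAlgebra/Matrix/WeightFlagSubmodule`),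
  given a Bruhat factorisation `h₂h₁⁻¹ = p₂ w p₁` adapted to `(a₂, a₁)`
  (`LinearAlgebra/Matrix/BruhatTwoWeights`): transport both pairs to the common `ĥ = p₁h₁`, where
  uniqueness forces `a₁ = a₂ ∘ π⁻¹`.
* §5 **Kempf's Cor. 4.4 for `SL_σ` on forms** (`exists_submodule_stable_of_not_isPolystable_of_bruhat`):
  a non-zero proper subspace of `K^σ` mapped into itself by every `γ ∈ SL_σ(K)` with `γ·v = v` —
  `Stab(v) ⊆ P(λ_v)`, a proper parabolic. Stated modulo the Bruhat-with-flag-transport input as an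
  explicit hypothesis (discharged from `BruhatTwoWeights` / `WeightFlagSubmodule`). With
  `MS2001Thm46OfKempfParabolic.lean` (Mulmuley–Sohoni's irreducibility of the stabilisers of
  `det_m`, `per_n`) this yields `MS2001_thm_4_6` / `MS2001_thm_4_7` over every algebraically closed
  field.

DEFINITIONS (with bodies; no named facts): `rpairLinearMap`, `TestSystem.IsOpt`. Deviation from
Kempf's text, recorded: we never form the spherical building or `X_*(G)`; real weight vectors
`a ∈ ℝ^σ` modulo the action of `P_a` and of the monomial matrices replace it, and the length is the
standard Euclidean norm on `ℝ^σ ⊇ {∑ a = 0} = X_*(D_SL) ⊗ ℝ` (the `W = S_σ`-invariant norm). Honest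
framing: classical geometric invariant theory (1978) in the tree's currency; nothing here bears on
`VP` versus `VNP`. Cell `val-lit`, seat t14 g7 (architect of programme #9; bricks C, D, flags and
glue by p5 g6).

## References

* [Kempf1978] G. R. Kempf, *Instability in invariant theory*, Ann. of Math. (2) 108 (1978)
  299–316: Thm. 2.2, §3 (Lemma 3.2, Thm. 3.4, Cor. 3.5), §4 (Cor. 4.4, Cor. 4.5) (cite-only).
* [MumfordFogartyKirwan1994] D. Mumford, J. Fogarty, F. Kirwan, *Geometric Invariant Theory*, 3rd
  ed., Ch. 2 §2 (the flag complex, Kempf–Rousseau), held (`book:mumford1994-geometric-invariant-theory`).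
* [MulmuleySohoniSIAM2001] K. Mulmuley, M. Sohoni, *GCT I*, SIAM J. Comput. 31 (2001), §3 and
  Thms. 4.6/4.7 ("By Kempf's criterion [23] the orbit is closed").
-/

noncomputable section

open scoped BigOperators
open MvPolynomial Literature.LinearAlgebra.Matrix Literature.Analysis.Convex

namespace Literature.Computability.AlgebraicComplexity

variable {K : Type} [Field K] {σ : Type} [Fintype σ] [DecidableEq σ] {D : ℕ}

/-! ### §1. The pairing as a linear form; states are non-empty off the closed orbit -/

/-- `a ↦ ⟨a, m⟩` as an `ℝ`-linear form on `ℝ^σ`. [cite: Kempf1978, §2 (the pairing)] -/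
def rpairLinearMap (m : σ → ℤ) : (σ → ℝ) →ₗ[ℝ] ℝ where
  toFun a := rpair a m
  map_add' a b := by
    simp only [rpair_apply, Pi.add_apply, add_mul, Finset.sum_add_distrib]
  map_smul' t a := by
    simp only [rpair_apply, Pi.smul_apply, smul_eq_mul, RingHom.id_apply, Finset.mul_sum, mul_assoc]

omit [DecidableEq σ] in
/-- Unfolding `rpairLinearMap`. [cite: Kempf1978, §2 (the pairing)] -/
theorem rpairLinearMap_apply (m : σ → ℤ) (a : σ → ℝ) : rpairLinearMap m a = rpair a m := rfl

variable {Q : MvPolynomial σ K} (T : TestSystem D Q)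

/-- The numerical function on a non-empty state as a minimum of linear forms.
[cite: Kempf1978, Lemma 3.2] -/
theorem TestSystem.M_eq_inf'_linear {u : MvPolynomial σ K} (hJ : (T.J u).Nonempty) (a : σ → ℝ) :
    T.M u a = (T.J u).inf' hJ (fun j => rpairLinearMap (T.m j) a) :=
  T.M_eq_inf' hJ a

/-- `M(u, t•a) = t M(u, a)` for `t ≥ 0`. [cite: Kempf1978, Lemma 3.2] -/
theorem TestSystem.M_smul {u : MvPolynomial σ K} (hJ : (T.J u).Nonempty) {t : ℝ} (ht : 0 ≤ t)
    (a : σ → ℝ) : T.M u (t • a) = t * T.M u a := by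
  rw [T.M_eq_inf'_linear hJ, T.M_eq_inf'_linear hJ]
  exact inf'_linear_posHom _ hJ _ ht a

/-- `M(u, ·)` is superadditive. [cite: Kempf1978, Lemma 3.2] -/
theorem TestSystem.M_superadditive {u : MvPolynomial σ K} (hJ : (T.J u).Nonempty) (a b : σ → ℝ) :
    T.M u a + T.M u b ≤ T.M u (a + b) := by
  rw [T.M_eq_inf'_linear hJ, T.M_eq_inf'_linear hJ, T.M_eq_inf'_linear hJ]
  exact inf'_linear_superadditive _ hJ _ a b

/-- `M(u, ·)` is continuous. [cite: Kempf1978, Lemma 3.2] -/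
theorem TestSystem.continuous_M {u : MvPolynomial σ K} (hJ : (T.J u).Nonempty) :
    Continuous fun a : σ → ℝ => T.M u a := by
  have h : (fun a : σ → ℝ => T.M u a) = fun a => (T.J u).inf' hJ (fun j => rpairLinearMap (T.m j) a) :=
    funext fun a => T.M_eq_inf'_linear hJ a
  rw [h]
  exact continuous_inf'_linear _ hJ _

omit [DecidableEq σ] in
/-- Admissibility is preserved by positive scaling. [cite: Kempf1978, §2] -/
theorem IsAdm.smul {u : MvPolynomial σ K} {a : σ → ℝ} (h : IsAdm u a) {t : ℝ} (ht : 0 ≤ t) :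
    IsAdm u (t • a) := by
  intro d hd
  have := h d hd
  simp only [Pi.smul_apply, smul_eq_mul, mul_assoc, ← Finset.mul_sum]
  exact mul_nonneg ht this

omit [DecidableEq σ] in
/-- Admissibility is preserved by sums. [cite: Kempf1978, §2] -/
theorem IsAdm.add {u : MvPolynomial σ K} {a b : σ → ℝ} (ha : IsAdm u a) (hb : IsAdm u b) :
    IsAdm u (a + b) := by
  intro d hd
  simp only [Pi.add_apply, add_mul, Finset.sum_add_distrib]
  exact add_nonneg (ha d hd) (hb d hd)

omit [DecidableEq σ] in
/-- The feasible cone `{a : ∑ a = 0, (u,a) admissible}` is closed. [cite: Kempf1978, §2] -/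
theorem isClosed_feasible (u : MvPolynomial σ K) :
    IsClosed {a : σ → ℝ | ∑ i, a i = 0 ∧ IsAdm u a} := by
  have hset : {a : σ → ℝ | ∑ i, a i = 0 ∧ IsAdm u a} =
      {a : σ → ℝ | ∑ i, a i = 0} ∩ ⋂ d ∈ u.support, {a : σ → ℝ | 0 ≤ ∑ i, a i * (d i : ℝ)} := by
    ext a
    simp only [Set.mem_setOf_eq, Set.mem_inter_iff, Set.mem_iInter, IsAdm]
  rw [hset]
  refine (isClosed_eq (continuous_finsetSum _ fun i _ => continuous_apply i) continuous_const).inter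
    (isClosed_biInter fun d _ => ?_)
  exact isClosed_le continuous_const
    (continuous_finsetSum _ fun i _ => (continuous_apply i).mul continuous_const)

/-- **Off the closed orbit every state is non-empty**: if `Q` is polystable and `v` (forms of
degree `D`) is not, then for every `h ∈ SL` some test polynomial does not vanish at `h·v`
(otherwise `h·v ∈ cl(SL·Q) = SL·Q`, making `v` polystable). [cite: Kempf1978, Lemma 3.2] -/
theorem TestSystem.J_nonempty_of_not_isPolystable (hQ : IsPolystable Q) (hQD : Q.IsHomogeneous D)
    {v : MvPolynomial σ K} (hv : v.IsHomogeneous D) (hnp : ¬ IsPolystable v)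
    (h : Matrix.SpecialLinearGroup σ K) :
    (T.J (linSubst σ K (h : Matrix σ σ K) v)).Nonempty := by
  by_contra hJ
  have hcl := T.coeffVec_mem_zariskiClosure_of_J_eq_empty hQD (linSubst_isHomogeneous _ hv) hJ
  obtain ⟨_, ⟨g, rfl⟩, hg⟩ := hQ hcl
  apply hnp
  refine hQ.of_mem_slOrbit ⟨h⁻¹ * g, ?_⟩
  rw [Matrix.SpecialLinearGroup.coe_mul, linSubst_mul, AlgHom.comp_apply, coeffVec_injective hg,
    ← AlgHom.comp_apply, ← linSubst_mul, ← Matrix.SpecialLinearGroup.coe_mul, inv_mul_cancel,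
    Matrix.SpecialLinearGroup.coe_one, linSubst_one, AlgHom.id_apply]

/-! ### §2. Optimal pairs: existence (finitely many states, compactness) -/

/-- **Optimal pairs** `(h, a)`: `a` is a unit (`∑ a_i² = 1`) admissible traceless weight vector at
`h·v` whose numerical value `M(h·v, a)` is maximal among all such pairs — Kempf's `Λ_x`, the set of
indivisible one-parameter subgroups `λ` maximising `m(x,λ)/‖λ‖`, written with `λ = h⁻¹ diag(t^a) h`.
[cite: Kempf1978, Thm. 2.2, Thm. 3.4 (the class `Λ_x`)] -/
def TestSystem.IsOpt (v : MvPolynomial σ K) (h : Matrix.SpecialLinearGroup σ K) (a : σ → ℝ) : Prop :=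
  (∑ i, a i = 0 ∧ IsAdm (linSubst σ K (h : Matrix σ σ K) v) a ∧ ∑ i, a i ^ 2 = 1) ∧
    ∀ (h' : Matrix.SpecialLinearGroup σ K) (a' : σ → ℝ), ∑ i, a' i = 0 →
      IsAdm (linSubst σ K (h' : Matrix σ σ K) v) a' → ∑ i, a' i ^ 2 = 1 →
      T.M (linSubst σ K (h' : Matrix σ σ K) v) a' ≤ T.M (linSubst σ K (h : Matrix σ σ K) v) a

/-- **A pair of positive value exists for a non-polystable form** (Hilbert–Mumford / Kempf Thm. 1.4
`exists_sl_diagLimit_mem_of_mem_zariskiClosure_slOrbit` + positivity at the limit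
`M_pos_of_diagLimit_mem`, normalised to the unit sphere). [cite: Kempf1978, Thm. 1.4, Lemma 3.2] -/
theorem TestSystem.exists_unit_M_pos [IsAlgClosed K] (hQ : IsPolystable Q) (hQD : Q.IsHomogeneous D)
    {v : MvPolynomial σ K} (hv : v.IsHomogeneous D) (hnp : ¬ IsPolystable v)
    (hQcl : coeffVec Q ∈ zariskiClosure (coeffVec '' slOrbit σ K v)) :
    ∃ (h : Matrix.SpecialLinearGroup σ K) (a : σ → ℝ), ∑ i, a i = 0 ∧
      IsAdm (linSubst σ K (h : Matrix σ σ K) v) a ∧ ∑ i, a i ^ 2 = 1 ∧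
      0 < T.M (linSubst σ K (h : Matrix σ σ K) v) a := by
  -- Hilbert–Mumford into `S = coeffVec '' SL·Q`
  have hstab : ∀ (g : Matrix.SpecialLinearGroup σ K) (q : MvPolynomial σ K),
      coeffVec q ∈ coeffVec '' slOrbit σ K Q →
      coeffVec (linSubst σ K (g : Matrix σ σ K) q) ∈ coeffVec '' slOrbit σ K Q := by
    rintro g q ⟨_, ⟨g', rfl⟩, hq⟩
    rw [← coeffVec_injective hq]
    refine ⟨_, ⟨g * g', rfl⟩, ?_⟩
    rw [Matrix.SpecialLinearGroup.coe_mul, linSubst_mul, AlgHom.comp_apply]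
  obtain ⟨h, a₀, ha₀, hadm, hlim⟩ := exists_sl_diagLimit_mem_of_mem_zariskiClosure_slOrbit hQcl hQ
    hstab ⟨Q, mem_slOrbit_self Q, rfl⟩
  obtain ⟨_, ⟨g, rfl⟩, hg⟩ := hlim
  have hlim' : diagLimit a₀ (linSubst σ K (h : Matrix σ σ K) v) ∈ slOrbit σ K Q :=
    ⟨g, (coeffVec_injective hg).symm⟩
  have hJ := T.J_nonempty_of_not_isPolystable hQ hQD hv hnp h
  have hpos := T.M_pos_of_diagLimit_mem ha₀ hadm hlim' hJ
  -- normalise the integral weight vector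
  set a : σ → ℝ := fun i => (a₀ i : ℝ) with ha
  have hadmR : IsAdm (linSubst σ K (h : Matrix σ σ K) v) a := isAdm_intCast_iff.mpr hadm
  have hsum : ∑ i, a i = 0 := by rw [ha, ← Int.cast_sum, ha₀, Int.cast_zero]
  have hne : 0 < ∑ i, a i ^ 2 := by
    rcases (Finset.sum_nonneg fun i (_ : i ∈ Finset.univ) => sq_nonneg (a i)).lt_or_eq with hlt | heq
    · exact hlt
    · exfalso
      have ha0 : a = 0 := by
        funext i
        have := (Finset.sum_eq_zero_iff_of_nonneg fun j (_ : j ∈ Finset.univ) => sq_nonneg (a j)).mp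
          heq.symm i (Finset.mem_univ i)
        exact pow_eq_zero_iff (n := 2) (by norm_num) |>.mp this
      rw [ha0] at hpos
      have h0 : T.M (linSubst σ K (h : Matrix σ σ K) v) (0 : σ → ℝ) = 0 := by
        have := T.M_smul hJ (le_refl (0 : ℝ)) (0 : σ → ℝ)
        rwa [zero_smul, zero_mul] at this
      rw [h0] at hpos
      exact lt_irrefl _ hpos
  set c : ℝ := Real.sqrt (∑ i, a i ^ 2) with hc
  have hc_pos : 0 < c := Real.sqrt_pos.mpr hne
  refine ⟨h, c⁻¹ • a, ?_, hadmR.smul (inv_pos.mpr hc_pos).le, ?_, ?_⟩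
  · simp only [Pi.smul_apply, smul_eq_mul, ← Finset.mul_sum, hsum, mul_zero]
  · have : ∑ i, (c⁻¹ • a) i ^ 2 = c⁻¹ ^ 2 * ∑ i, a i ^ 2 := by
      rw [Finset.mul_sum]
      refine Finset.sum_congr rfl fun i _ => ?_
      simp only [Pi.smul_apply, smul_eq_mul]
      ring
    rw [this, ← Real.sq_sqrt hne.le, ← hc, inv_pow, inv_mul_cancel₀ (pow_ne_zero 2 hc_pos.ne')]
  · rw [T.M_smul hJ (inv_pos.mpr hc_pos).le]
    exact mul_pos (inv_pos.mpr hc_pos) hpos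

/-- `M` only depends on the state. [cite: Kempf1978, Lemma 3.2] -/
theorem TestSystem.M_congr_J {u u' : MvPolynomial σ K} (hJ : T.J u = T.J u') (a : σ → ℝ) :
    T.M u a = T.M u' a := by
  unfold TestSystem.M
  rw [hJ]

omit [DecidableEq σ] in
/-- Admissibility only depends on the support. [cite: Kempf1978, §2] -/
theorem isAdm_congr_support {u u' : MvPolynomial σ K} (hs : u.support = u'.support) (a : σ → ℝ) :
    IsAdm u a ↔ IsAdm u' a := by
  unfold IsAdm
  rw [hs]

/-- **Finitely many states**: the map `h ↦ (J(h·v), supp(h·v))` has finite range for a form `v`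
of degree `D`. [cite: Kempf1978, Thm. 3.4 (finitely many states)] -/
theorem TestSystem.finite_range_state {v : MvPolynomial σ K} (hv : v.IsHomogeneous D) :
    (Set.range fun h : Matrix.SpecialLinearGroup σ K =>
      (T.J (linSubst σ K (h : Matrix σ σ K) v), (linSubst σ K (h : Matrix σ σ K) v).support)).Finite := by
  apply Set.Finite.subset (s := (↑((Finset.univ : Finset (Finset (Fin T.r))) ×ˢ
    (degMonomials σ D).powerset) : Set (Finset (Fin T.r) × Finset (σ →₀ ℕ))))
  · exact Finset.finite_toSet _
  · rintro _ ⟨h, rfl⟩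
    simp only [Finset.coe_product, Set.mem_prod, Finset.mem_coe, Finset.mem_univ, true_and,
      Finset.mem_powerset]
    intro d hd
    rw [mem_degMonomials_iff]
    by_contra hdeg
    exact (mem_support_iff.mp hd) ((linSubst_isHomogeneous (h : Matrix σ σ K) hv).coeff_eq_zero hdeg)

/-- **A maximiser on one state** (compactness half of Kempf's Thm. 2.2): given `h` with a feasible
unit vector, some feasible unit `b` at `h` dominates every feasible unit vector at every `h'` in
the same state. [cite: Kempf1978, Thm. 2.2 (existence)] -/
theorem TestSystem.exists_max_on_state (hQ : IsPolystable Q) (hQD : Q.IsHomogeneous D)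
    {v : MvPolynomial σ K} (hv : v.IsHomogeneous D) (hnp : ¬ IsPolystable v)
    (h : Matrix.SpecialLinearGroup σ K) {a : σ → ℝ} (ha : ∑ i, a i = 0)
    (hadm : IsAdm (linSubst σ K (h : Matrix σ σ K) v) a) (h1 : ∑ i, a i ^ 2 = 1) :
    ∃ b : σ → ℝ, ∑ i, b i = 0 ∧ IsAdm (linSubst σ K (h : Matrix σ σ K) v) b ∧ ∑ i, b i ^ 2 = 1 ∧
      ∀ (h' : Matrix.SpecialLinearGroup σ K) (a' : σ → ℝ),
        T.J (linSubst σ K (h' : Matrix σ σ K) v) = T.J (linSubst σ K (h : Matrix σ σ K) v) →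
        (linSubst σ K (h' : Matrix σ σ K) v).support = (linSubst σ K (h : Matrix σ σ K) v).support →
        ∑ i, a' i = 0 → IsAdm (linSubst σ K (h' : Matrix σ σ K) v) a' → ∑ i, a' i ^ 2 = 1 →
        T.M (linSubst σ K (h' : Matrix σ σ K) v) a' ≤ T.M (linSubst σ K (h : Matrix σ σ K) v) b := by
  have hJ := T.J_nonempty_of_not_isPolystable hQ hQD hv hnp h
  obtain ⟨b, hbC, hb1, hbmax⟩ := exists_max_on_cone_sphere
    (isClosed_feasible (linSubst σ K (h : Matrix σ σ K) v)) (T.continuous_M hJ) ⟨a, ⟨ha, hadm⟩, h1⟩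
  refine ⟨b, hbC.1, hbC.2, hb1, fun h' a' hJ' hs' ha' hadm' h1' => ?_⟩
  rw [T.M_congr_J hJ']
  exact hbmax a' ⟨ha', (isAdm_congr_support hs' a').mp hadm'⟩ h1'

/-- **Existence of optimal pairs** (Kempf Thm. 2.2 / Thm. 3.4, existence: the numerical function
and admissibility of `(h, a)` only depend on the STATE `(J(h·v), supp(h·v))` of `h`, of which there
are finitely many; on each state the unit feasible vectors form a compact set on which the
continuous `M` attains its maximum; a pair of positive value exists by Thm. 1.4).
[cite: Kempf1978, Thm. 2.2, Thm. 3.4] -/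
theorem TestSystem.exists_isOpt [IsAlgClosed K] (hQ : IsPolystable Q) (hQD : Q.IsHomogeneous D)
    {v : MvPolynomial σ K} (hv : v.IsHomogeneous D) (hnp : ¬ IsPolystable v)
    (hQcl : coeffVec Q ∈ zariskiClosure (coeffVec '' slOrbit σ K v)) :
    ∃ (h : Matrix.SpecialLinearGroup σ K) (a : σ → ℝ), T.IsOpt v h a := by
  classical
  -- the good states: realised with a feasible unit vector
  let st : Matrix.SpecialLinearGroup σ K → Finset (Fin T.r) × Finset (σ →₀ ℕ) := fun h =>
    (T.J (linSubst σ K (h : Matrix σ σ K) v), (linSubst σ K (h : Matrix σ σ K) v).support)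
  let good : Set (Finset (Fin T.r) × Finset (σ →₀ ℕ)) :=
    {p | ∃ (h : Matrix.SpecialLinearGroup σ K) (a : σ → ℝ), st h = p ∧ ∑ i, a i = 0 ∧
      IsAdm (linSubst σ K (h : Matrix σ σ K) v) a ∧ ∑ i, a i ^ 2 = 1}
  have hgf : good.Finite := (T.finite_range_state hv).subset (by
    rintro p ⟨h, a, hp, -⟩
    exact ⟨h, hp⟩)
  -- a maximiser on each good state
  have hmax : ∀ p ∈ good, ∃ (h : Matrix.SpecialLinearGroup σ K) (b : σ → ℝ), st h = p ∧
      ∑ i, b i = 0 ∧ IsAdm (linSubst σ K (h : Matrix σ σ K) v) b ∧ ∑ i, b i ^ 2 = 1 ∧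
      ∀ (h' : Matrix.SpecialLinearGroup σ K) (a' : σ → ℝ), st h' = p → ∑ i, a' i = 0 →
        IsAdm (linSubst σ K (h' : Matrix σ σ K) v) a' → ∑ i, a' i ^ 2 = 1 →
        T.M (linSubst σ K (h' : Matrix σ σ K) v) a' ≤ T.M (linSubst σ K (h : Matrix σ σ K) v) b := by
    rintro p ⟨h, a, hst_h, ha, hadm, h1⟩
    obtain ⟨b, hb, hbadm, hb1, hbmax⟩ := T.exists_max_on_state hQ hQD hv hnp h ha hadm h1
    refine ⟨h, b, hst_h, hb, hbadm, hb1, fun h' a' hst' ha' hadm' h1' => ?_⟩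
    have he : st h' = st h := hst'.trans hst_h.symm
    exact hbmax h' a' (congrArg Prod.fst he) (congrArg Prod.snd he) ha' hadm' h1'
  choose hsel bsel hprops using hmax
  -- the best good state
  obtain ⟨h₀, a₀, ha₀, hadm₀, h1₀, -⟩ := T.exists_unit_M_pos hQ hQD hv hnp hQcl
  have hg₀ : st h₀ ∈ good := ⟨h₀, a₀, rfl, ha₀, hadm₀, h1₀⟩
  let val : Finset (Fin T.r) × Finset (σ →₀ ℕ) → ℝ :=
    fun p => if hp : p ∈ good then T.M (linSubst σ K (hsel p hp : Matrix σ σ K) v) (bsel p hp) else 0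
  obtain ⟨p₀, hp₀, hbest⟩ := hgf.toFinset.exists_max_image val ⟨st h₀, hgf.mem_toFinset.mpr hg₀⟩
  have hp₀g : p₀ ∈ good := hgf.mem_toFinset.mp hp₀
  obtain ⟨-, hsum₀, hadm₀', h1₀', -⟩ := hprops p₀ hp₀g
  refine ⟨hsel p₀ hp₀g, bsel p₀ hp₀g, ⟨hsum₀, hadm₀', h1₀'⟩, fun h' a' ha' hadm' h1' => ?_⟩
  have hg' : st h' ∈ good := ⟨h', a', rfl, ha', hadm', h1'⟩
  obtain ⟨-, -, -, -, hloc'⟩ := hprops (st h') hg'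
  have hb := hbest (st h') (hgf.mem_toFinset.mpr hg')
  have hv1 : val (st h') = T.M (linSubst σ K (hsel (st h') hg' : Matrix σ σ K) v) (bsel (st h') hg') :=
    dif_pos hg'
  have hv2 : val p₀ = T.M (linSubst σ K (hsel p₀ hp₀g : Matrix σ σ K) v) (bsel p₀ hp₀g) :=
    dif_pos hp₀g
  rw [hv1, hv2] at hb
  exact (hloc' h' a' rfl ha' hadm' h1').trans hb

/-- **Optimal pairs have positive value.** [cite: Kempf1978, Thm. 2.2] -/
theorem TestSystem.IsOpt.M_pos [IsAlgClosed K] (hQ : IsPolystable Q) (hQD : Q.IsHomogeneous D)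
    {v : MvPolynomial σ K} (hv : v.IsHomogeneous D) (hnp : ¬ IsPolystable v)
    (hQcl : coeffVec Q ∈ zariskiClosure (coeffVec '' slOrbit σ K v))
    {h : Matrix.SpecialLinearGroup σ K} {a : σ → ℝ} (hopt : T.IsOpt v h a) :
    0 < T.M (linSubst σ K (h : Matrix σ σ K) v) a := by
  obtain ⟨h₀, a₀, ha₀, hadm₀, h1₀, hpos⟩ := T.exists_unit_M_pos hQ hQD hv hnp hQcl
  exact lt_of_lt_of_le hpos (hopt.2 h₀ a₀ ha₀ hadm₀ h1₀)

/-- Two optimal pairs have the same value. [cite: Kempf1978, Thm. 2.2] -/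
theorem TestSystem.IsOpt.M_eq {v : MvPolynomial σ K} {h h' : Matrix.SpecialLinearGroup σ K}
    {a a' : σ → ℝ} (hopt : T.IsOpt v h a) (hopt' : T.IsOpt v h' a') :
    T.M (linSubst σ K (h : Matrix σ σ K) v) a = T.M (linSubst σ K (h' : Matrix σ σ K) v) a' :=
  le_antisymm (hopt'.2 h a hopt.1.1 hopt.1.2.1 hopt.1.2.2) (hopt.2 h' a' hopt'.1.1 hopt'.1.2.1 hopt'.1.2.2)

/-! ### §3. Transport of optimal pairs: stabiliser, parabolic, Weyl group; uniqueness per state -/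

/-- **The stabiliser permutes optimal pairs**: `γ·v = v ⇒ (hγ, a)` optimal iff `(h, a)` is
(`(hγ)·v = h·v`). [cite: Kempf1978, Cor. 3.5] -/
theorem TestSystem.IsOpt.mul_stabilizer {v : MvPolynomial σ K} {h : Matrix.SpecialLinearGroup σ K}
    {a : σ → ℝ} (hopt : T.IsOpt v h a) (γ : Matrix.SpecialLinearGroup σ K)
    (hγ : linSubst σ K (γ : Matrix σ σ K) v = v) : T.IsOpt v (h * γ) a := by
  unfold TestSystem.IsOpt at hopt ⊢
  rw [linSubst_mul_of_stabilizer h γ hγ]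
  exact hopt

/-- **`P_a` moves optimal pairs to optimal pairs with the same weight vector** (Kempf's Lemma
3.2 (c)): for `q ∈ SL ∩ P_a` (`q`, `q⁻¹` block-triangular for `toDual ∘ a`), `(h, a)` optimal
⇒ `(qh, a)` optimal. [cite: Kempf1978, Lemma 3.2 (c), Thm. 3.4] -/
theorem TestSystem.IsOpt.parabolic_mul [Infinite K] (hQ : IsPolystable Q) (hQD : Q.IsHomogeneous D)
    {v : MvPolynomial σ K} (hv : v.IsHomogeneous D) (hnp : ¬ IsPolystable v)
    {h : Matrix.SpecialLinearGroup σ K} {a : σ → ℝ} (hopt : T.IsOpt v h a)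
    (q : Matrix.SpecialLinearGroup σ K)
    (hq : (q : Matrix σ σ K).BlockTriangular (OrderDual.toDual ∘ a))
    (hqi : ((q⁻¹ : Matrix.SpecialLinearGroup σ K) : Matrix σ σ K).BlockTriangular
      (OrderDual.toDual ∘ a)) :
    T.IsOpt v (q * h) a := by
  obtain ⟨⟨ha, hadm, h1⟩, hmax⟩ := hopt
  have hJ := T.J_nonempty_of_not_isPolystable hQ hQD hv hnp h
  obtain ⟨hadm', -, hMeq⟩ := T.M_linSubst_eq_of_parabolic q ha
    ((blockTriangular_toDual_comp_iff _ a).mp hq) ((blockTriangular_toDual_comp_iff _ a).mp hqi)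
    hadm hJ
  refine ⟨⟨ha, ?_, h1⟩, fun h' a' ha' hadm'' h1' => ?_⟩
  · rw [Matrix.SpecialLinearGroup.coe_mul, linSubst_mul, AlgHom.comp_apply]
    exact hadm'
  · rw [Matrix.SpecialLinearGroup.coe_mul, linSubst_mul, AlgHom.comp_apply, hMeq]
    exact hmax h' a' ha' hadm'' h1'

/-- **A monomial matrix moves an optimal pair to an optimal pair with permuted weights** (the
Weyl group acting on `X_*(T)`): if `w ∈ SL` is monomial over `π₀` (`w_{ij} ≠ 0 ⇒ i = π₀ j`,
`w⁻¹` monomial over `π₀⁻¹`) and `(wh, a)` is optimal then `(h, a ∘ π₀)` is optimal.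
[cite: Kempf1978, §2 (the Weyl group acting on `X_*(T)`), Thm. 3.4] -/
theorem TestSystem.IsOpt.of_monomial_mul [Infinite K] (hQ : IsPolystable Q) (hQD : Q.IsHomogeneous D)
    {v : MvPolynomial σ K} (hv : v.IsHomogeneous D) (hnp : ¬ IsPolystable v)
    {h : Matrix.SpecialLinearGroup σ K} {a : σ → ℝ} (w : Matrix.SpecialLinearGroup σ K)
    (π₀ : Equiv.Perm σ) (hw : ∀ i j, (w : Matrix σ σ K) i j ≠ 0 → i = π₀ j)
    (hwi : ∀ i j, ((w⁻¹ : Matrix.SpecialLinearGroup σ K) : Matrix σ σ K) i j ≠ 0 → i = π₀.symm j)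
    (hopt : T.IsOpt v (w * h) a) : T.IsOpt v h (a ∘ π₀) := by
  obtain ⟨⟨ha, hadm, h1⟩, hmax⟩ := hopt
  have hJ := T.J_nonempty_of_not_isPolystable hQ hQD hv hnp (w * h)
  have hcomp : (a ∘ π₀) ∘ π₀.symm = a := by
    funext i
    simp
  have ha' : ∑ i, (a ∘ π₀) i = 0 := by
    rw [← ha]
    exact Equiv.sum_comp π₀ a
  rw [Matrix.SpecialLinearGroup.coe_mul, linSubst_mul, AlgHom.comp_apply] at hadm hJ hmax
  obtain ⟨hadm', -, hMeq⟩ := T.M_linSubst_eq_of_perm w⁻¹ π₀.symm hwi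
    (by rw [inv_inv, Equiv.symm_symm]; exact hw) (a := a ∘ π₀) ha'
    (u := linSubst σ K (w : Matrix σ σ K) (linSubst σ K (h : Matrix σ σ K) v))
    (by rw [hcomp]; exact hadm) hJ
  have hu : linSubst σ K ((w⁻¹ : Matrix.SpecialLinearGroup σ K) : Matrix σ σ K)
      (linSubst σ K (w : Matrix σ σ K) (linSubst σ K (h : Matrix σ σ K) v)) =
      linSubst σ K (h : Matrix σ σ K) v := by
    rw [← AlgHom.comp_apply, ← linSubst_mul, ← Matrix.SpecialLinearGroup.coe_mul, inv_mul_cancel,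
      Matrix.SpecialLinearGroup.coe_one, linSubst_one, AlgHom.id_apply]
  rw [hu, hcomp] at hMeq
  rw [hu] at hadm'
  refine ⟨⟨ha', hadm', ?_⟩, fun h' a' ha'' hadm'' h1' => ?_⟩
  · rw [← h1]
    exact Equiv.sum_comp π₀ (fun i => a i ^ 2)
  · rw [hMeq]
    exact hmax h' a' ha'' hadm'' h1'

/-- **Uniqueness of the optimal weight vector at a fixed `h`** (the convexity half of Kempf's
Thm. 2.2): two optimal pairs `(h, a)`, `(h, b)` with the same `h` have `a = b`.
[cite: Kempf1978, Thm. 2.2 (uniqueness)] -/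
theorem TestSystem.IsOpt.unique [IsAlgClosed K] (hQ : IsPolystable Q) (hQD : Q.IsHomogeneous D)
    {v : MvPolynomial σ K} (hv : v.IsHomogeneous D) (hnp : ¬ IsPolystable v)
    (hQcl : coeffVec Q ∈ zariskiClosure (coeffVec '' slOrbit σ K v))
    {h : Matrix.SpecialLinearGroup σ K} {a b : σ → ℝ} (ha : T.IsOpt v h a) (hb : T.IsOpt v h b) :
    a = b := by
  have hJ := T.J_nonempty_of_not_isPolystable hQ hQD hv hnp h
  refine eq_of_max_on_cone_sphere (C := {a : σ → ℝ | ∑ i, a i = 0 ∧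
      IsAdm (linSubst σ K (h : Matrix σ σ K) v) a})
    (F := fun a => T.M (linSubst σ K (h : Matrix σ σ K) v) a)
    (fun a ha' b hb' => ⟨?_, ha'.2.add hb'.2⟩) (fun t ht a ha' => ⟨?_, ha'.2.smul ht.le⟩)
    (fun t ht a => T.M_smul hJ ht.le a) (T.M_superadditive hJ)
    (ha.M_pos T hQ hQD hv hnp hQcl) (fun b' hb' h1' => ha.2 h b' hb'.1 hb'.2 h1')
    ⟨ha.1.1, ha.1.2.1⟩ ⟨hb.1.1, hb.1.2.1⟩ ha.1.2.2 hb.1.2.2 rfl (hb.M_eq T ha)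
  · simp only [Pi.add_apply, Finset.sum_add_distrib, ha'.1, hb'.1, add_zero]
  · simp only [Pi.smul_apply, smul_eq_mul, ← Finset.mul_sum, ha'.1, mul_zero]

/-! ### §4. The canonical flag: all optimal pairs define the same flag -/

/-- **Kempf's Thm. 2.2 / Thm. 3.4 (uniqueness of `Λ_x` up to its parabolic) for `SL_σ` on forms,
flag form**: two optimal pairs `(h₁, a₁)`, `(h₂, a₂)` define the same weight flag
`F(h, a, r) = {x : ∀ i, a_i < r → (h x)_i = 0}` for every `r`. Inputs: a Bruhat factorisation
`h₂ h₁⁻¹ = p₂ · w · p₁` (`p_i ∈ P_{a_i}`, `w` monomial over `π⁻¹`, with the transport of flags by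
`w`), the `P_a`-invariance and Weyl covariance of the numerical function (part II), and the
uniqueness of the optimal unit vector at a fixed `h` (convexity). [cite: Kempf1978, Thm. 2.2, Thm. 3.4] -/
theorem TestSystem.IsOpt.flag_eq [IsAlgClosed K] (hQ : IsPolystable Q) (hQD : Q.IsHomogeneous D)
    {v : MvPolynomial σ K} (hv : v.IsHomogeneous D) (hnp : ¬ IsPolystable v)
    (hQcl : coeffVec Q ∈ zariskiClosure (coeffVec '' slOrbit σ K v))
    {h₁ h₂ : Matrix.SpecialLinearGroup σ K} {a₁ a₂ : σ → ℝ}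
    (hopt₁ : T.IsOpt v h₁ a₁) (hopt₂ : T.IsOpt v h₂ a₂)
    (p₂ w p₁ : Matrix.SpecialLinearGroup σ K) (π : Equiv.Perm σ)
    (hp₂ : (p₂ : Matrix σ σ K).BlockTriangular (OrderDual.toDual ∘ a₂))
    (hp₂i : ((p₂⁻¹ : Matrix.SpecialLinearGroup σ K) : Matrix σ σ K).BlockTriangular
      (OrderDual.toDual ∘ a₂))
    (hp₁ : (p₁ : Matrix σ σ K).BlockTriangular (OrderDual.toDual ∘ a₁))
    (hp₁i : ((p₁⁻¹ : Matrix.SpecialLinearGroup σ K) : Matrix σ σ K).BlockTriangular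
      (OrderDual.toDual ∘ a₁))
    (hw : ∀ i j, (w : Matrix σ σ K) i j ≠ 0 → i = π.symm j)
    (hwi : ∀ i j, ((w⁻¹ : Matrix.SpecialLinearGroup σ K) : Matrix σ σ K) i j ≠ 0 → i = π j)
    (hflagw : ∀ (h : Matrix σ σ K) (a : σ → ℝ) (r : ℝ),
      (Submodule.pi {i : σ | a i < r} (fun _ => (⊥ : Submodule K K))).comap
          ((w : Matrix σ σ K) * h).mulVecLin =
        (Submodule.pi {i : σ | (a ∘ π.symm) i < r} (fun _ => (⊥ : Submodule K K))).comap
          h.mulVecLin)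
    (hg : h₂ * h₁⁻¹ = p₂ * w * p₁) (r : ℝ) :
    (Submodule.pi {i : σ | a₁ i < r} (fun _ => (⊥ : Submodule K K))).comap
        (h₁ : Matrix σ σ K).mulVecLin =
      (Submodule.pi {i : σ | a₂ i < r} (fun _ => (⊥ : Submodule K K))).comap
        (h₂ : Matrix σ σ K).mulVecLin := by
  -- the common adapted element `ĥ = p₁ h₁`, with `h₂ = p₂ w ĥ`
  have hopt₁' : T.IsOpt v (p₁ * h₁) a₁ := hopt₁.parabolic_mul T hQ hQD hv hnp p₁ hp₁ hp₁i
  have hh₂ : h₂ = p₂ * (w * (p₁ * h₁)) := by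
    have := congrArg (· * h₁) hg
    simp only [inv_mul_cancel_right] at this
    rw [this]
    simp only [mul_assoc]
  have hopt₂' : T.IsOpt v (w * (p₁ * h₁)) a₂ := by
    have h := hopt₂.parabolic_mul T hQ hQD hv hnp p₂⁻¹ hp₂i (by rw [inv_inv]; exact hp₂)
    rwa [hh₂, inv_mul_cancel_left] at h
  have hopt₃ : T.IsOpt v (p₁ * h₁) (a₂ ∘ π.symm) :=
    hopt₂'.of_monomial_mul T hQ hQD hv hnp w π.symm hw (by rw [Equiv.symm_symm]; exact hwi)
  have heq : a₁ = a₂ ∘ π.symm := hopt₁'.unique T hQ hQD hv hnp hQcl hopt₃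
  -- compare the flags
  have hdet : ∀ g : Matrix.SpecialLinearGroup σ K, IsUnit (g : Matrix σ σ K).det := fun g => by
    rw [g.det_coe]
    exact isUnit_one
  rw [hh₂, Matrix.SpecialLinearGroup.coe_mul, Matrix.SpecialLinearGroup.coe_mul,
    weightFlag_parabolic_mul r hp₂ (hdet p₂), hflagw, ← heq, Matrix.SpecialLinearGroup.coe_mul,
    weightFlag_parabolic_mul r hp₁ (hdet p₁)]

/-! ### §5. Kempf's theorem for `SL_σ` on forms: the stabiliser preserves the canonical flag -/

/-- **Kempf's theorem (1978, Cor. 4.4) for `SL_σ` acting on forms, over any algebraically closed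
field, modulo the Bruhat decomposition with flag transport** (supplied by
`LinearAlgebra/Matrix/BruhatTwoWeights.lean` and `WeightFlagSubmodule.lean`): if the form `v` of
degree `D` is NOT polystable (its `SL`-orbit is not Zariski closed), there is a non-zero proper
subspace `W ⊆ K^σ` — a step of the canonical destabilising flag — mapped into itself by every
`γ ∈ SL_σ(K)` fixing `v`. Equivalently `Stab(v) ⊆ P(λ_v)`, a proper parabolic subgroup.
[cite: Kempf1978, Cor. 4.4, Thm. 3.4] -/
theorem exists_submodule_stable_of_not_isPolystable_of_bruhat [IsAlgClosed K]
    {v : MvPolynomial σ K} (hv : v.IsHomogeneous D) (hnp : ¬ IsPolystable v)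
    (bruhat : ∀ (a₁ a₂ : σ → ℝ) (g : Matrix.SpecialLinearGroup σ K),
      ∃ (p₂ w p₁ : Matrix.SpecialLinearGroup σ K) (π : Equiv.Perm σ),
        (p₂ : Matrix σ σ K).BlockTriangular (OrderDual.toDual ∘ a₂) ∧
        ((p₂⁻¹ : Matrix.SpecialLinearGroup σ K) : Matrix σ σ K).BlockTriangular
          (OrderDual.toDual ∘ a₂) ∧
        (p₁ : Matrix σ σ K).BlockTriangular (OrderDual.toDual ∘ a₁) ∧
        ((p₁⁻¹ : Matrix.SpecialLinearGroup σ K) : Matrix σ σ K).BlockTriangular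
          (OrderDual.toDual ∘ a₁) ∧
        (∀ i j, (w : Matrix σ σ K) i j ≠ 0 → i = π.symm j) ∧
        (∀ i j, ((w⁻¹ : Matrix.SpecialLinearGroup σ K) : Matrix σ σ K) i j ≠ 0 → i = π j) ∧
        (∀ (h : Matrix σ σ K) (a : σ → ℝ) (r : ℝ),
          (Submodule.pi {i : σ | a i < r} (fun _ => (⊥ : Submodule K K))).comap
              ((w : Matrix σ σ K) * h).mulVecLin =
            (Submodule.pi {i : σ | (a ∘ π.symm) i < r} (fun _ => (⊥ : Submodule K K))).comap
              h.mulVecLin) ∧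
        g = p₂ * w * p₁) :
    ∃ W : Submodule K (σ → K), W ≠ ⊥ ∧ W ≠ ⊤ ∧
      ∀ γ : Matrix.SpecialLinearGroup σ K, linSubst σ K (γ : Matrix σ σ K) v = v →
        ∀ x ∈ W, (γ : Matrix σ σ K).mulVec x ∈ W := by
  classical
  -- a closed orbit in the closure and its test system
  obtain ⟨Q, hQD, hQcl, hQ⟩ := exists_isPolystable_mem_zariskiClosure hv
  obtain ⟨T⟩ := nonempty_testSystem (D := D) Q
  -- an optimal pair
  obtain ⟨h, a, hopt⟩ := T.exists_isOpt hQ hQD hv hnp hQcl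
  have ha0 : a ≠ 0 := by
    intro h0
    have h1 := hopt.1.2.2
    rw [h0] at h1
    simp at h1
  have hdet : IsUnit (h : Matrix σ σ K).det := by
    rw [h.det_coe]
    exact isUnit_one
  obtain ⟨r, hbot, htop⟩ := exists_weightFlag_ne_bot_ne_top_of_sum_eq_zero hdet ha0 hopt.1.1
  refine ⟨_, hbot, htop, fun γ hγ x hx => ?_⟩
  -- `(hγ, a)` is optimal, hence defines the same flag
  have hopt' : T.IsOpt v (h * γ) a := hopt.mul_stabilizer T γ hγ
  obtain ⟨p₂, w, p₁, π, hp₂, hp₂i, hp₁, hp₁i, hw, hwi, hflagw, hg⟩ := bruhat a a (h * γ * h⁻¹)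
  have heq := hopt.flag_eq T hQ hQD hv hnp hQcl hopt' p₂ w p₁ π hp₂ hp₂i hp₁ hp₁i hw hwi hflagw hg r
  rw [Matrix.SpecialLinearGroup.coe_mul] at heq
  exact mulVec_mem_weightFlag_of_eq heq.symm hx

end Literature.Computability.AlgebraicComplexity
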